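import Summits.ABC.IUTFork.Joshi.ATS4MainTheorem
import Literature.IUT.LogVolume.Corollary23JInv
import HarnessLib

/-!
# Joshi, *Arithmetic Teichmüller Spaces IV* (arXiv:2403.10430v2): the p.10 dictionary «[IUTchIV] Cor. 2.2 = Thm 5.7.1,
# [IUTchIV] Cor. 2.3 = Thm 7.1.1» AT THE LEVEL OF THE §2 STATEMENTS — our [IUTchIV] Cor. 2.2 typing feeds Joshi's §2 Props

Record/bridge file of the abc-iut cell, branch E (rung LADDER-ABC:A2.E; seat abc-iut-E-t24, slot T-24, companion of
`ATS4Statements.lean` / `ATS4MainTheorem.lean`). PROOF-ONLY: no new claim `Prop`, nothing asserted. [J-IV] p.10 l.1–9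
(«[Mochizuki, 2021d, Corollary 2.2] = Theorem 5.7.1 … [Mochizuki, 2021d, Corollary 2.3] = Theorem 7.1.1») and Rmk. 2.10.2
(p.34 l.23–25: «the strategy of the proof of Theorem 2.10.1 is to prove [Thm 2.8.1 (2)] for a given compactly bounded subset
supported on a suitable finite set of primes») say that the §2 endpoints are reached through statement (2) of Thm. 2.8.1 at a
finite set of primes. The tree already holds [IUTchIV] Cor. 2.2 as a TYPED HYPOTHESIS `Literature.IUT.LogVolume.Cor22.Corollary22
Hunif` (its printed proof applies [IUTchIV] Thm. 1.10, which rests on the disputed [IUTchIII] Cor. 3.12 — TAKEN AS A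
HYPOTHESIS here, never asserted) together with the kernel-checked chain `Cor22.abcCompactlyBounded_two_of_corollary22` and
`Cor22.jInvVacuous_holds` ([IUTchIV] Cor. 2.3, proof p. 55). This file records, in kernel currency and in the vocabulary
of Joshi's §2 as typed, what that hypothesis delivers:

* `abcOnCompactlyBoundedSubsets_two_of_corollary22` — `Cor22.Corollary22 Hunif` ⟹ Joshi's Thm. 2.8.1 (2) at `S = {2}` for
  EVERY degree `d ≥ 1` (the conclusion SHAPE his Thm. 5.7.1 / Thm. 7.1.1 typings (slots T-28 / T-33) must deliver);
* `consequences_of_corollary22` — adding the FACT-LIST fact F-1336 `GenEll.GenEll_thm21_primes` ([GenEll] Thm. 2.1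
  (ii) ⟹ (i)|_{ℙ¹}): Joshi's strong abc-conjecture 2.6.1, his abc-conjecture 2.1.1, the summit statement `ABC`, and his
  Arithmetic Szpiro Conjecture 2.2.1 — all AS IMPLICATIONS from the two named hypotheses;
* `mainTheorem_tripod_of_corollary22` — under the same two hypotheses, Joshi's «Main Theorem» 2.10.1 holds for the
  one-member family consisting of the tripod `(ℙ¹_ℚ, {0,1,∞})` (= the `ℙ¹` case of [IUTchIV] Cor. 2.3; general curves need
  the Belyi-map reduction of [GenEll] Thm. 2.1 for all `(X, D)`, not in the tree — TODO(general form)).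

No side is taken on [IUTchIII] Cor. 3.12, on Joshi's claims, or on Mochizuki's report on them; typed ≠ proved ≠ endorsed; NO
abc claim (every theorem below has `Cor22.Corollary22 Hunif` among its hypotheses). [cite: Joshi2024ATS4, p.10 l.1–9]
[claim: Mochizuki2012, status: disputed]; [cite: MochizukiGenEll2010]; standard axioms only.
-/

noncomputable section

open Literature.NumberTheory.DiophantineGeometry Literature.NumberTheory.DiophantineGeometry.GenEll
open Literature.NumberTheory.EllipticCurves Literature.IUT.LogVolume

namespace Summit.ABC.IUTFork.Joshi.ATS4

/-- **«[IUTchIV] Cor. 2.2» (our typing, as a hypothesis) ⟹ Joshi's Thm. 2.8.1 (2) at `S = {2}`, every `d ≥ 1`**: for every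
`ε > 0` and every compactly bounded `K_V ⊆ ℙ¹ ∖ {0,1,∞}` whose support contains `2`, `ht ≲ (1+ε)(log-diff + log-con)` on
`K_V ∩ U(Q̄)_{≤d}`. Kernel content = the tree's `Cor22.abcCompactlyBounded_two_of_corollary22` (proof of [IUTchIV] Cor. 2.3,
p. 55) with the vacuity input discharged by `Cor22.jInvVacuous_holds`, read through `abcCompactlyBounded_iff`. The shape Joshi's
p.10 dictionary assigns to his Thm. 5.7.1 / 7.1.1 (Rmk. 2.10.2). An implication; `Corollary22` is NOT asserted.
[cite: Joshi2024ATS4, p.10 l.1–9] -/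
theorem abcOnCompactlyBoundedSubsets_two_of_corollary22 {Hunif : ℝ} (h22 : Cor22.Corollary22 Hunif) {d : ℕ}
    (hd : 0 < d) : AbcOnCompactlyBoundedSubsets ({2} : Finset ℕ) d :=
  (abcCompactlyBounded_iff {2}).mp (Cor22.abcCompactlyBounded_two_of_corollary22 h22 Cor22.jInvVacuous_holds) d hd

/-- **«[IUTchIV] Cor. 2.2» (hypothesis) + F-1336 `GenEll_thm21_primes` (hypothesis) ⟹ Joshi's §2 endpoints**: the strong
abc-conjecture 2.6.1, the abc-conjecture 2.1.1 (his `ℤ`-form), the summit statement `ABC`, and the Arithmetic Szpiro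
Conjecture 2.2.1 — PROVED AS AN IMPLICATION (via `ABC_of_abcOnCompactlyBounded`, `abcConjecture_of_strongAbcConjecture`,
`szpiroConjecture_of_strongAbcConjecture`). Nothing is asserted; this is [J-IV] Thm. 2.10.1 (1)–(2)|_ℚ read backwards to the
inputs the tree actually has. [cite: Joshi2024ATS4, Thm 2.10.1 p.34 l.18–20] -/
theorem consequences_of_corollary22 {Hunif : ℝ} (h22 : Cor22.Corollary22 Hunif) (hfact : GenEll_thm21_primes) :
    StrongAbcConjecture ∧ AbcConjecture ∧ ABC ∧ ArithmeticSzpiroConjecture := by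
  have h2 : ∀ p ∈ ({2} : Finset ℕ), p.Prime := fun p hp => by
    rw [Finset.mem_singleton] at hp; subst hp; exact Nat.prime_two
  obtain ⟨hs, hA⟩ := ABC_of_abcOnCompactlyBounded hfact h2
    (fun d hd => abcOnCompactlyBoundedSubsets_two_of_corollary22 h22 hd)
  exact ⟨hs, abcConjecture_of_strongAbcConjecture hs, hA, (szpiroConjecture_of_strongAbcConjecture hs).1⟩

/-- **Joshi's «Main Theorem» 2.10.1 FOR THE TRIPOD ALONE** (the one-member family `(ℙ¹_ℚ, {0,1,∞})`, = the `ℙ¹` case of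
[IUTchIV] Cor. 2.3) follows from «[IUTchIV] Cor. 2.2» (hypothesis) and F-1336 (hypothesis) — PROVED as an implication. For
the genuine family of all hyperbolic `(X, D)/L` the tree lacks the height machine and the Belyi-map reduction of [GenEll]
Thm. 2.1 (TODO(general form)); nothing is asserted. [cite: Joshi2024ATS4, Thm 2.10.1 p.34 l.13–17] -/
theorem mainTheorem_tripod_of_corollary22 {Hunif : ℝ} (h22 : Cor22.Corollary22 Hunif) (hfact : GenEll_thm21_primes) :
    MainTheorem (fun _ : PUnit.{1} => CurveHeightDatum.tripod) :=
  fun _ => vojtaHeightInequality_tripod_iff.mpr (consequences_of_corollary22 h22 hfact).1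

end Summit.ABC.IUTFork.Joshi.ATS4

end
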